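import Mathlib
import Summits.Ventures.PercRepro2.TB14CutSplit
import Summits.Ventures.PercRepro2.PosClass

/-!
# Transport of the position classes of typed Harris across a cut vertex
(blind cell PercRepro2, p5 g8, 2026-08-26; `proofs/P5-POSCLASS.md`, STATUS 01:43:10Z)

With the vocabulary of `PosClass.lean` (`odd`, `kOut`/`kRed`/`kBlue`/`kCore`, `stat`): if `x` is a
cut vertex separating `w` from `s, u, v` (`CutV.IsCut`), every class statistic of `w` is an
explicit nonnegative combination of the class statistics of `x` at the `s`-side profile and the
four class COUNTS of `w` w.r.t. the root `x` at the `w`-side profile — the product law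
`TB14Cut.pairCount_mul_of_cut` (domain Markov in the profile-wise vocabulary) applied to the
composition rules `kOut_across` … (`stat_out_of_cut`, `stat_red_of_cut`, `stat_blue_of_cut`,
`stat_core_of_cut`).  **Corollary** (`tb13_of_cut`, `classD_of_cut`, `classB_of_cut`,
`classTriple_of_cut`): the triple {(TB13), (D), (B)} at `x` implies the triple at `w` — the core
class enters only through typed Harris `0 ≤ out + red + blue + core` — so the triple reduces to the
instances where no cut vertex separates `w` from the other three marks.  Own work; standard axioms.
-/

namespace Summit.Ventures.PercRepro2

namespace PosClass

open CovForm A3InactiveTyped CutV TB14Cut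

section Cut

variable {V : Type*} {E : Type*} {R : Type*} [Field R]
  {ends : E → Sym2 V} {x : V} {VA VB : Set V} {EA EB : Set E}
  [DecidablePred (· ∈ EA)] [DecidablePred (· ∈ EB)] [Fintype E] [DecidableEq E]

/-- **Product law for a class statistic**: an `A`-side class kernel times a `B`-side kernel. -/
theorem stat_mul_of_cut (h : IsCut ends x VA VB EA EB) (F : Finset E) (z : Config E) {s u v : V}
    (hs : s ∈ VA ∪ {x}) (hu : u ∈ VA ∪ {x}) (hv : v ∈ VA ∪ {x})
    (kA kB : Config E → Config E → R)
    (hkA : ∀ y y', kA y y' = kA (restrict EA y) (restrict EA y'))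
    (hkB : ∀ y y', kB y y' = kB (restrict EB y) (restrict EB y')) :
    pairCount F z (fun y y' => odd ends s u y y' * odd ends s v y y' * kA y y' * kB y y') =
      stat (sideFree EA F) (restrict EA z) ends s u v kA *
        pairCount (sideFree EB F) (restrict EB z) kB := by
  have key := pairCount_mul_of_cut (R := R) h F z
    (fun y y' => odd ends s u y y' * odd ends s v y y' * kA y y') kB ?_ hkB
  · exact key
  · intro y y'
    rw [odd_restrictA h hs hu y y', odd_restrictA h hs hv y y', hkA y y']

/-- **Transport of the class «outside both clusters» across a cut vertex**: with `x` separating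
`w` from `s, u, v`, `N_s(f_u f_v; w ∉ Y) = (out + red + blue + core)_x · out_{x→w} + out_x ·
(red + blue + core)_{x→w} + red_x · blue_{x→w} + blue_x · red_{x→w}`, where the `x`-classes are the
statistics at the `A`-side profile and the `x→w`-classes the counts of the classes of `w` w.r.t. the
root `x` at the `B`-side profile. -/
theorem stat_out_of_cut (h : IsCut ends x VA VB EA EB) (F : Finset E) (z : Config E)
    {s u v w : V} (hs : s ∈ VA ∪ {x}) (hu : u ∈ VA ∪ {x}) (hv : v ∈ VA ∪ {x}) (hw : w ∈ VB) :
    (stat F z ends s u v (kOut ends s w) : R) =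
      (stat (sideFree EA F) (restrict EA z) ends s u v (kOut ends s x) +
        stat (sideFree EA F) (restrict EA z) ends s u v (kRed ends s x) +
        stat (sideFree EA F) (restrict EA z) ends s u v (kBlue ends s x) +
        stat (sideFree EA F) (restrict EA z) ends s u v (kCore ends s x)) *
        pairCount (sideFree EB F) (restrict EB z) (kOut ends x w) +
      stat (sideFree EA F) (restrict EA z) ends s u v (kOut ends s x) *
        (pairCount (sideFree EB F) (restrict EB z) (kRed ends x w) +
          pairCount (sideFree EB F) (restrict EB z) (kBlue ends x w) +
          pairCount (sideFree EB F) (restrict EB z) (kCore ends x w)) +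
      stat (sideFree EA F) (restrict EA z) ends s u v (kRed ends s x) *
        pairCount (sideFree EB F) (restrict EB z) (kBlue ends x w) +
      stat (sideFree EA F) (restrict EA z) ends s u v (kBlue ends s x) *
        pairCount (sideFree EB F) (restrict EB z) (kRed ends x w) := by
  have hA := iL_sx_restrictA (R := R) h hs
  have hB := iL_xw_restrictB (R := R) h hw
  have e1 := stat_mul_of_cut h F z hs hu hv (kOut ends s x) (kOut ends x w)
    (kOut_restrict hA) (kOut_restrict hB)
  have e2 := stat_mul_of_cut h F z hs hu hv (kOut ends s x) (kRed ends x w)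
    (kOut_restrict hA) (kRed_restrict hB)
  have e3 := stat_mul_of_cut h F z hs hu hv (kOut ends s x) (kBlue ends x w)
    (kOut_restrict hA) (kBlue_restrict hB)
  have e4 := stat_mul_of_cut h F z hs hu hv (kOut ends s x) (kCore ends x w)
    (kOut_restrict hA) (kCore_restrict hB)
  have e5 := stat_mul_of_cut h F z hs hu hv (kRed ends s x) (kOut ends x w)
    (kRed_restrict hA) (kOut_restrict hB)
  have e6 := stat_mul_of_cut h F z hs hu hv (kRed ends s x) (kBlue ends x w)
    (kRed_restrict hA) (kBlue_restrict hB)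
  have e7 := stat_mul_of_cut h F z hs hu hv (kBlue ends s x) (kOut ends x w)
    (kBlue_restrict hA) (kOut_restrict hB)
  have e8 := stat_mul_of_cut h F z hs hu hv (kBlue ends s x) (kRed ends x w)
    (kBlue_restrict hA) (kRed_restrict hB)
  have e9 := stat_mul_of_cut h F z hs hu hv (kCore ends s x) (kOut ends x w)
    (kCore_restrict hA) (kOut_restrict hB)
  have hsum : (stat F z ends s u v (kOut ends s w) : R) =
      pairCount F z (fun y y' => odd ends s u y y' * odd ends s v y y' * kOut ends s x y y' *
        kOut ends x w y y') +
      pairCount F z (fun y y' => odd ends s u y y' * odd ends s v y y' * kOut ends s x y y' *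
        kRed ends x w y y') +
      pairCount F z (fun y y' => odd ends s u y y' * odd ends s v y y' * kOut ends s x y y' *
        kBlue ends x w y y') +
      pairCount F z (fun y y' => odd ends s u y y' * odd ends s v y y' * kOut ends s x y y' *
        kCore ends x w y y') +
      pairCount F z (fun y y' => odd ends s u y y' * odd ends s v y y' * kRed ends s x y y' *
        kOut ends x w y y') +
      pairCount F z (fun y y' => odd ends s u y y' * odd ends s v y y' * kRed ends s x y y' *
        kBlue ends x w y y') +
      pairCount F z (fun y y' => odd ends s u y y' * odd ends s v y y' * kBlue ends s x y y' *
        kOut ends x w y y') +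
      pairCount F z (fun y y' => odd ends s u y y' * odd ends s v y y' * kBlue ends s x y y' *
        kRed ends x w y y') +
      pairCount F z (fun y y' => odd ends s u y y' * odd ends s v y y' * kCore ends s x y y' *
        kOut ends x w y y') := by
    rw [← pairCount_add, ← pairCount_add, ← pairCount_add, ← pairCount_add, ← pairCount_add,
      ← pairCount_add, ← pairCount_add, ← pairCount_add]
    unfold stat pairCount
    refine Finset.sum_congr rfl fun y _ => ?_
    split_ifs
    · simp only [kOut_across h hs hw]
      ring
    · rfl
  rw [hsum, e1, e2, e3, e4, e5, e6, e7, e8, e9]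
  ring

/-- **Transport of the class «red-only»**: `N_s(f_u f_v; w ∈ S ∖ S') = (red + core)_x · red_{x→w}
+ red_x · core_{x→w}`. -/
theorem stat_red_of_cut (h : IsCut ends x VA VB EA EB) (F : Finset E) (z : Config E)
    {s u v w : V} (hs : s ∈ VA ∪ {x}) (hu : u ∈ VA ∪ {x}) (hv : v ∈ VA ∪ {x}) (hw : w ∈ VB) :
    (stat F z ends s u v (kRed ends s w) : R) =
      (stat (sideFree EA F) (restrict EA z) ends s u v (kRed ends s x) +
        stat (sideFree EA F) (restrict EA z) ends s u v (kCore ends s x)) *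
        pairCount (sideFree EB F) (restrict EB z) (kRed ends x w) +
      stat (sideFree EA F) (restrict EA z) ends s u v (kRed ends s x) *
        pairCount (sideFree EB F) (restrict EB z) (kCore ends x w) := by
  have hA := iL_sx_restrictA (R := R) h hs
  have hB := iL_xw_restrictB (R := R) h hw
  have e1 := stat_mul_of_cut h F z hs hu hv (kRed ends s x) (kRed ends x w)
    (kRed_restrict hA) (kRed_restrict hB)
  have e2 := stat_mul_of_cut h F z hs hu hv (kRed ends s x) (kCore ends x w)
    (kRed_restrict hA) (kCore_restrict hB)
  have e3 := stat_mul_of_cut h F z hs hu hv (kCore ends s x) (kRed ends x w)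
    (kCore_restrict hA) (kRed_restrict hB)
  have hsum : (stat F z ends s u v (kRed ends s w) : R) =
      pairCount F z (fun y y' => odd ends s u y y' * odd ends s v y y' * kRed ends s x y y' *
        kRed ends x w y y') +
      pairCount F z (fun y y' => odd ends s u y y' * odd ends s v y y' * kRed ends s x y y' *
        kCore ends x w y y') +
      pairCount F z (fun y y' => odd ends s u y y' * odd ends s v y y' * kCore ends s x y y' *
        kRed ends x w y y') := by
    rw [← pairCount_add, ← pairCount_add]
    unfold stat pairCount
    refine Finset.sum_congr rfl fun y _ => ?_
    split_ifs
    · simp only [kRed_across h hs hw]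
      ring
    · rfl
  rw [hsum, e1, e2, e3]
  ring

/-- **Transport of the class «blue-only»**: `N_s(f_u f_v; w ∈ S' ∖ S) = (blue + core)_x ·
blue_{x→w} + blue_x · core_{x→w}`. -/
theorem stat_blue_of_cut (h : IsCut ends x VA VB EA EB) (F : Finset E) (z : Config E)
    {s u v w : V} (hs : s ∈ VA ∪ {x}) (hu : u ∈ VA ∪ {x}) (hv : v ∈ VA ∪ {x}) (hw : w ∈ VB) :
    (stat F z ends s u v (kBlue ends s w) : R) =
      (stat (sideFree EA F) (restrict EA z) ends s u v (kBlue ends s x) +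
        stat (sideFree EA F) (restrict EA z) ends s u v (kCore ends s x)) *
        pairCount (sideFree EB F) (restrict EB z) (kBlue ends x w) +
      stat (sideFree EA F) (restrict EA z) ends s u v (kBlue ends s x) *
        pairCount (sideFree EB F) (restrict EB z) (kCore ends x w) := by
  have hA := iL_sx_restrictA (R := R) h hs
  have hB := iL_xw_restrictB (R := R) h hw
  have e1 := stat_mul_of_cut h F z hs hu hv (kBlue ends s x) (kBlue ends x w)
    (kBlue_restrict hA) (kBlue_restrict hB)
  have e2 := stat_mul_of_cut h F z hs hu hv (kBlue ends s x) (kCore ends x w)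
    (kBlue_restrict hA) (kCore_restrict hB)
  have e3 := stat_mul_of_cut h F z hs hu hv (kCore ends s x) (kBlue ends x w)
    (kCore_restrict hA) (kBlue_restrict hB)
  have hsum : (stat F z ends s u v (kBlue ends s w) : R) =
      pairCount F z (fun y y' => odd ends s u y y' * odd ends s v y y' * kBlue ends s x y y' *
        kBlue ends x w y y') +
      pairCount F z (fun y y' => odd ends s u y y' * odd ends s v y y' * kBlue ends s x y y' *
        kCore ends x w y y') +
      pairCount F z (fun y y' => odd ends s u y y' * odd ends s v y y' * kCore ends s x y y' *
        kBlue ends x w y y') := by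
    rw [← pairCount_add, ← pairCount_add]
    unfold stat pairCount
    refine Finset.sum_congr rfl fun y _ => ?_
    split_ifs
    · simp only [kBlue_across h hs hw]
      ring
    · rfl
  rw [hsum, e1, e2, e3]
  ring

/-- **Transport of the core class**: `N_s(f_u f_v; w ∈ S ∩ S') = core_x · core_{x→w}`. -/
theorem stat_core_of_cut (h : IsCut ends x VA VB EA EB) (F : Finset E) (z : Config E)
    {s u v w : V} (hs : s ∈ VA ∪ {x}) (hu : u ∈ VA ∪ {x}) (hv : v ∈ VA ∪ {x}) (hw : w ∈ VB) :
    (stat F z ends s u v (kCore ends s w) : R) =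
      stat (sideFree EA F) (restrict EA z) ends s u v (kCore ends s x) *
        pairCount (sideFree EB F) (restrict EB z) (kCore ends x w) := by
  have hA := iL_sx_restrictA (R := R) h hs
  have hB := iL_xw_restrictB (R := R) h hw
  rw [← stat_mul_of_cut h F z hs hu hv (kCore ends s x) (kCore ends x w)
    (kCore_restrict hA) (kCore_restrict hB)]
  unfold stat pairCount
  refine Finset.sum_congr rfl fun y _ => ?_
  split_ifs
  · simp only [kCore_across h hs hw]
    ring
  · rfl

end Cut

/-! ## The corollary: the triple {(TB13), (D), (B)} passes a cut vertex -/

section Corollary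

variable {V : Type*} {E : Type*} [Fintype E] [DecidableEq E] {R : Type*} [Field R]
  [LinearOrder R] [IsStrictOrderedRing R] {ends : E → Sym2 V} {x : V} {VA VB : Set V} {EA EB : Set E}
  [DecidablePred (· ∈ EA)] [DecidablePred (· ∈ EB)]


/-- **(TB13) passes a cut vertex**: with `x` separating `w` from `s, u, v`, (TB13), (D) (both
colours) at `x` on the `s`-side profile give (TB13) at `w` — the core class enters only through
typed Harris `0 ≤ out + red + blue + core`. -/
theorem tb13_of_cut (h : IsCut ends x VA VB EA EB) (F : Finset E) (z : Config E) {s u v w : V}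
    (hs : s ∈ VA ∪ {x}) (hu : u ∈ VA ∪ {x}) (hv : v ∈ VA ∪ {x}) (hw : w ∈ VB)
    (hout : 0 ≤ (stat (sideFree EA F) (restrict EA z) ends s u v (kOut ends s x) : R))
    (hred : 0 ≤ (stat (sideFree EA F) (restrict EA z) ends s u v (kRed ends s x) : R))
    (hblue : 0 ≤ (stat (sideFree EA F) (restrict EA z) ends s u v (kBlue ends s x) : R)) :
    0 ≤ (stat F z ends s u v (kOut ends s w) : R) := by
  rw [stat_out_of_cut h F z hs hu hv hw]
  have hH : (0 : R) ≤ stat (sideFree EA F) (restrict EA z) ends s u v (kOut ends s x) +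
      stat (sideFree EA F) (restrict EA z) ends s u v (kRed ends s x) +
      stat (sideFree EA F) (restrict EA z) ends s u v (kBlue ends s x) +
      stat (sideFree EA F) (restrict EA z) ends s u v (kCore ends s x) := by
    rw [stat_sum_classes]
    exact stat_one_nonneg _ _ ends s u v
  have c1 := pairCount_nonneg' (R := R) (sideFree EB F) (restrict EB z) (kOut ends x w) (kOut_nonneg ends x w)
  have c2 := pairCount_nonneg' (R := R) (sideFree EB F) (restrict EB z) (kRed ends x w) (kRed_nonneg ends x w)
  have c3 := pairCount_nonneg' (R := R) (sideFree EB F) (restrict EB z) (kBlue ends x w) (kBlue_nonneg ends x w)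
  have c4 := pairCount_nonneg' (R := R) (sideFree EB F) (restrict EB z) (kCore ends x w) (kCore_nonneg ends x w)
  have t1 := mul_nonneg hH c1
  have t2 := mul_nonneg hout (add_nonneg (add_nonneg c2 c3) c4)
  have t3 := mul_nonneg hred c3
  have t4 := mul_nonneg hblue c2
  linarith

/-- **(D) passes a cut vertex**: (D) and (B) at `x` give (D) at `w`. -/
theorem classD_of_cut (h : IsCut ends x VA VB EA EB) (F : Finset E) (z : Config E) {s u v w : V}
    (hs : s ∈ VA ∪ {x}) (hu : u ∈ VA ∪ {x}) (hv : v ∈ VA ∪ {x}) (hw : w ∈ VB)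
    (hred : 0 ≤ (stat (sideFree EA F) (restrict EA z) ends s u v (kRed ends s x) : R))
    (hB : 0 ≤ (stat (sideFree EA F) (restrict EA z) ends s u v (kRed ends s x) : R) +
      stat (sideFree EA F) (restrict EA z) ends s u v (kCore ends s x)) :
    0 ≤ (stat F z ends s u v (kRed ends s w) : R) := by
  rw [stat_red_of_cut h F z hs hu hv hw]
  have c2 := pairCount_nonneg' (R := R) (sideFree EB F) (restrict EB z) (kRed ends x w) (kRed_nonneg ends x w)
  have c4 := pairCount_nonneg' (R := R) (sideFree EB F) (restrict EB z) (kCore ends x w) (kCore_nonneg ends x w)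
  exact add_nonneg (mul_nonneg hB c2) (mul_nonneg hred c4)

/-- The blue (D) passes a cut vertex. -/
theorem classDb_of_cut (h : IsCut ends x VA VB EA EB) (F : Finset E) (z : Config E) {s u v w : V}
    (hs : s ∈ VA ∪ {x}) (hu : u ∈ VA ∪ {x}) (hv : v ∈ VA ∪ {x}) (hw : w ∈ VB)
    (hblue : 0 ≤ (stat (sideFree EA F) (restrict EA z) ends s u v (kBlue ends s x) : R))
    (hB : 0 ≤ (stat (sideFree EA F) (restrict EA z) ends s u v (kBlue ends s x) : R) +
      stat (sideFree EA F) (restrict EA z) ends s u v (kCore ends s x)) :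
    0 ≤ (stat F z ends s u v (kBlue ends s w) : R) := by
  rw [stat_blue_of_cut h F z hs hu hv hw]
  have c3 := pairCount_nonneg' (R := R) (sideFree EB F) (restrict EB z) (kBlue ends x w) (kBlue_nonneg ends x w)
  have c4 := pairCount_nonneg' (R := R) (sideFree EB F) (restrict EB z) (kCore ends x w) (kCore_nonneg ends x w)
  exact add_nonneg (mul_nonneg hB c3) (mul_nonneg hblue c4)

/-- **(B) passes a cut vertex, by itself**: `(red + core)_w = (red + core)_x · (red + core)_{x→w}`. -/
theorem classB_of_cut (h : IsCut ends x VA VB EA EB) (F : Finset E) (z : Config E) {s u v w : V}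
    (hs : s ∈ VA ∪ {x}) (hu : u ∈ VA ∪ {x}) (hv : v ∈ VA ∪ {x}) (hw : w ∈ VB)
    (hB : 0 ≤ (stat (sideFree EA F) (restrict EA z) ends s u v (kRed ends s x) : R) +
      stat (sideFree EA F) (restrict EA z) ends s u v (kCore ends s x)) :
    0 ≤ (stat F z ends s u v (kRed ends s w) : R) + stat F z ends s u v (kCore ends s w) := by
  rw [stat_red_of_cut h F z hs hu hv hw, stat_core_of_cut h F z hs hu hv hw]
  have c2 := pairCount_nonneg' (R := R) (sideFree EB F) (restrict EB z) (kRed ends x w) (kRed_nonneg ends x w)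
  have c4 := pairCount_nonneg' (R := R) (sideFree EB F) (restrict EB z) (kCore ends x w) (kCore_nonneg ends x w)
  have e : ((stat (sideFree EA F) (restrict EA z) ends s u v (kRed ends s x) : R) +
        stat (sideFree EA F) (restrict EA z) ends s u v (kCore ends s x)) *
        pairCount (sideFree EB F) (restrict EB z) (kRed ends x w) +
      stat (sideFree EA F) (restrict EA z) ends s u v (kRed ends s x) *
        pairCount (sideFree EB F) (restrict EB z) (kCore ends x w) +
      stat (sideFree EA F) (restrict EA z) ends s u v (kCore ends s x) *
        pairCount (sideFree EB F) (restrict EB z) (kCore ends x w) =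
      (stat (sideFree EA F) (restrict EA z) ends s u v (kRed ends s x) +
        stat (sideFree EA F) (restrict EA z) ends s u v (kCore ends s x)) *
        (pairCount (sideFree EB F) (restrict EB z) (kRed ends x w) +
          pairCount (sideFree EB F) (restrict EB z) (kCore ends x w)) := by ring
  rw [e]
  exact mul_nonneg hB (add_nonneg c2 c4)

/-- The blue (B) passes a cut vertex. -/
theorem classBb_of_cut (h : IsCut ends x VA VB EA EB) (F : Finset E) (z : Config E) {s u v w : V}
    (hs : s ∈ VA ∪ {x}) (hu : u ∈ VA ∪ {x}) (hv : v ∈ VA ∪ {x}) (hw : w ∈ VB)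
    (hB : 0 ≤ (stat (sideFree EA F) (restrict EA z) ends s u v (kBlue ends s x) : R) +
      stat (sideFree EA F) (restrict EA z) ends s u v (kCore ends s x)) :
    0 ≤ (stat F z ends s u v (kBlue ends s w) : R) + stat F z ends s u v (kCore ends s w) := by
  rw [stat_blue_of_cut h F z hs hu hv hw, stat_core_of_cut h F z hs hu hv hw]
  have c3 := pairCount_nonneg' (R := R) (sideFree EB F) (restrict EB z) (kBlue ends x w) (kBlue_nonneg ends x w)
  have c4 := pairCount_nonneg' (R := R) (sideFree EB F) (restrict EB z) (kCore ends x w) (kCore_nonneg ends x w)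
  have e : ((stat (sideFree EA F) (restrict EA z) ends s u v (kBlue ends s x) : R) +
        stat (sideFree EA F) (restrict EA z) ends s u v (kCore ends s x)) *
        pairCount (sideFree EB F) (restrict EB z) (kBlue ends x w) +
      stat (sideFree EA F) (restrict EA z) ends s u v (kBlue ends s x) *
        pairCount (sideFree EB F) (restrict EB z) (kCore ends x w) +
      stat (sideFree EA F) (restrict EA z) ends s u v (kCore ends s x) *
        pairCount (sideFree EB F) (restrict EB z) (kCore ends x w) =
      (stat (sideFree EA F) (restrict EA z) ends s u v (kBlue ends s x) +
        stat (sideFree EA F) (restrict EA z) ends s u v (kCore ends s x)) *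
        (pairCount (sideFree EB F) (restrict EB z) (kBlue ends x w) +
          pairCount (sideFree EB F) (restrict EB z) (kCore ends x w)) := by ring
  rw [e]
  exact mul_nonneg hB (add_nonneg c3 c4)

/-- **The class triple passes a cut vertex**: if `x` is a cut vertex separating `w` from
`s, u, v`, the triple {(TB13), (D), (B)} at `x` on the `s`-side profile implies the triple at `w`
on the full profile. -/
theorem classTriple_of_cut (h : IsCut ends x VA VB EA EB) (F : Finset E) (z : Config E)
    {s u v w : V} (hs : s ∈ VA ∪ {x}) (hu : u ∈ VA ∪ {x}) (hv : v ∈ VA ∪ {x}) (hw : w ∈ VB)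
    (hx : ClassTriple (R := R) (sideFree EA F) (restrict EA z) ends s u v x) :
    ClassTriple (R := R) F z ends s u v w := by
  obtain ⟨hout, hred, hblue, hB, hBb⟩ := hx
  exact ⟨tb13_of_cut h F z hs hu hv hw hout hred hblue, classD_of_cut h F z hs hu hv hw hred hB,
    classDb_of_cut h F z hs hu hv hw hblue hBb, classB_of_cut h F z hs hu hv hw hB,
    classBb_of_cut h F z hs hu hv hw hBb⟩

end Corollary

end PosClass

end Summit.Ventures.PercRepro2
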